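import Summits.CriticalPhenomena.Ising3DConformalLimit.Theorems.EnergyNotSigmaSquaredMoebiusLimitExistsPedigreeAssembly
import Summits.CriticalPhenomena.Ising3DConformalLimit.Theorems.EnergyNotSigmaSquaredMoebiusLimitExistsDoubledThickening
import Summits.CriticalPhenomena.Ising3DConformalLimit.Theorems.EnergyNotSigmaSquaredMoebiusLimitExistsCompactnessSchema
import Summits.CriticalPhenomena.Ising3DConformalLimit.Theorems.EnergyNotSigmaSquaredMoebiusLimitExistsLocallyBounded
import Summits.CriticalPhenomena.Ising3DConformalLimit.Theorems.EnergyNotSigmaSquaredMoebiusLimitExistsTranslationInvariant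
import Summits.CriticalPhenomena.Ising3DConformalLimit.Theorems.EnergyNotSigmaSquaredMoebiusLimitExistsEquicontinuousTwo
import Summits.CriticalPhenomena.Ising3DConformalLimit.Theorems.EnergyNotSigmaSquaredMoebiusLimitExistsTelescoping
import Summits.CriticalPhenomena.Ising3DConformalLimit.Theorems.EnergyNotSigmaSquaredMoebiusLimitExistsPedigreeMono
import Summits.CriticalPhenomena.Ising3DConformalLimit.Theorems.EnergyNotSigmaSquaredMoebiusLimitExistsPedigreeCovering
import Summits.CriticalPhenomena.Ising3DConformalLimit.Theorems.EnergyNotSigmaSquaredMoebiusLimitExistsPedigreeCover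
import Summits.CriticalPhenomena.Ising3DConformalLimit.Theorems.EnergyNotSigmaSquaredMoebiusLimitExistsSVEquicontTransport
import HarnessLib

/-!
# Compactness of the pinned critical zoom with regular cluster points, modulo the recursion step
(STUB 1 of line `only-interaction-breaks-moebius`, crux `MoebiusLimitExists`, item
stmt-CriticalPhenomena-1344, route `EnergyNotSigmaSquared`; registered anchor `pinnedZoom_compactness_of_step`)

Every theorem of this file takes as its first hypothesis `hstep` THE CONTINUUM RECURSION STEP — the
statement proved by the landed `pedigreeStep clusterMoveIneq_cubic` (`…PedigreeStep.lean`, p105519), which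
is also the first hypothesis of the landed `pedigree_assembly`. The step is kept as a hypothesis only so that
this file elaborates against modules already built on the farm; the thin glue file
`…PinnedZoomCompactness.lean` specialises `hstep := pedigreeStep clusterMoveIneq_cubic` and states the
registered residue `stub_equicontinuity_inner` and `pinnedZoom_compactness` without hypotheses beyond the
two-point law.

Under the two-point law (the data of item stmt-0634 as hypotheses: `⟨σ₀σ_y⟩‖y‖^{2Δ} → c > 0`), the
pinned rescaled critical Ising correlators on `ℤ³`,
`F_δ(x) = ρ_pin(δ)ⁿ ⟨σ_{[x₁/δ]} ⋯ σ_{[xₙ/δ]}⟩_{β_c}`, are PRECOMPACT along every mesh sequence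
`u k → 0⁺`: some subsequence converges, for every order `n` at once, locally uniformly off the
diagonals to a REGULAR family (normalised, continuous off the diagonals, translation invariant).

Assembly of landed pieces only (all names below carry the suffix `_of_step`):
* `svEquicont_all` — single-variable asymptotic equicontinuity at every configuration, from the mirror
  pedigree machinery: `pedigree_cover ∘ covering_all` (every configuration has a pedigree with a positive
  margin), `pedigree_mono` (margins are 2-Lipschitz), `pedigree_assembly` (induction on the depth, fed
  with the recursion step `pedigreeStep clusterMoveIneq_cubic`, `svEquicont_transport`,
  `doubled_thickening`) and the locality lemma `svEquicont_of_locally_pa`;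
* `stub_equicontinuity_inner` — the registered residue 1″d, verbatim, now a theorem;
* `stub_equicontinuity_ge_four` — joint asymptotic equicontinuity at even orders `≥ 4` by
  `telescoping_equicontinuity`;
* `pinnedZoom_equicontinuity` — all orders (order 0 constant, odd orders vanish, order 2 landed);
* `pinnedZoom_compactness` — STUB 1, from `compactnessSchema`, `pinnedZoomLocallyBounded`,
  `pinnedZoomTranslationInvariant`.

References: H. Duminil-Copin, ICM 2022 §8.1, §8.4; J. Fröhlich, R. Israel, E. H. Lieb, B. Simon,
Comm. Math. Phys. 62 (1978) §2. No definitions; no `sorry`.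
-/

noncomputable section

open Filter Topology Set Function Metric
open Literature.Probability.LatticeModels

namespace Summit.CriticalPhenomena.Ising3DConformalLimit.MoebiusLimitExistsOnlyInteraction

/-- **Single-variable asymptotic equicontinuity of the pinned zoom at EVERY configuration (glue, kernel-checked;
no stub in its cone).** Under the two-point law, along every mesh sequence, on every compact `K ⊆ NonCoincident 3 n`
and for every index `i`: `SVEquicont u n K i`. Proof: by locality (`svEquicont_of_locally_pa`) it suffices to treat the
piece `closedBall x (μ/4) ∩ K` around each `x ∈ K`, where `μ > 0` is the margin of a mirror pedigree of `x` of some depth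
`d` (`pedigree_cover ∘ covering_all`); by `pedigree_mono` every configuration of the piece has a depth-`≤ d` pedigree
with margin `μ/2`, and `pedigree_assembly` (fed with `pedigreeStep`, `pedigree_mono`, `svEquicont_transport`,
`doubled_thickening`) concludes. [folklore] -/
theorem svEquicont_all_of_step
    (hstep : (∀ u : ℕ → ℝ, Tendsto u atTop (𝓝[>] (0 : ℝ)) →
        ∀ (a b : ℕ) (i₀ : Fin a) (g : Site 3), IsCubicDir g →
        ∀ (T κ η₀ M : ℝ), 0 < κ → 0 < η₀ →
        ∀ K : Set (Fin (a + b) → EuclideanSpace ℝ (Fin 3)), IsCompact K →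
        K ⊆ NonCoincident 3 (a + b) →
        (∀ x ∈ K, (∀ j : Fin a, rdotZ g (x (Fin.castAdd b j)) + κ ≤ T) ∧
          (∀ j : Fin b, T + κ ≤ rdotZ g (x (Fin.natAdd a j)))) →
        (∀ᶠ k in atTop, ∀ z ∈ Metric.cthickening η₀ (doubledB g T '' K),
          |rescaledCorrelator (criticalCorr 3) rhoPin (b + b) (u k) z| ≤ M) →
        SVEquicont u (a + a) (Metric.cthickening η₀ (doubledA g T '' K)) (Fin.castAdd a i₀) →
        SVEquicont u (a + b) K (Fin.castAdd b i₀)))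
    {Δ c : ℝ} (hc : 0 < c)
    (hG : Tendsto (fun y : Site 3 => criticalTwoPoint 3 y * Real.sqrt (∑ i, ((y i : ℝ)) ^ 2) ^ (2 * Δ))
      cofinite (𝓝 c))
    {u : ℕ → ℝ} (hu : Tendsto u atTop (𝓝[>] (0 : ℝ))) (n : ℕ)
    (K : Set (Fin n → EuclideanSpace ℝ (Fin 3))) (hK : IsCompact K) (hKs : K ⊆ NonCoincident 3 n) (i : Fin n) :
    SVEquicont u n K i := by
  refine svEquicont_of_locally_pa hK fun x hx => ?_
  obtain ⟨μ, hμ, d, hped⟩ := pedigree_cover covering_all n x (hKs hx) i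
  refine ⟨μ / 4, by positivity, ?_⟩
  refine pedigree_assembly hstep pedigree_mono svEquicont_transport doubled_thickening Δ c hc hG u hu d
    (μ / 2) (by positivity) n i _ (hK.inter_left Metric.isClosed_closedBall) (fun y hy => hKs hy.2) fun y hy => ?_
  have hdist : dist x y ≤ μ / 4 := by
    rw [dist_comm]
    exact Metric.mem_closedBall.1 hy.1
  have h := pedigree_mono μ (μ / 4) d n x y i hped hdist
  have hμ2 : μ - 2 * (μ / 4) = μ / 2 := by ring
  rwa [hμ2] at h

/-- **STUB 1″d — the RESIDUE `stub_equicontinuity_inner` modulo the recursion step `hstep`** (registered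
signature after `hstep`, verbatim: single-variable asymptotic equicontinuity at the configurations whose moving point is NOT
separated from the others by a coordinate slab of width `κ`, for some `κ > 0` of the prover's choice — here `κ = 1`,
and the non-separation hypothesis is simply not used, `svEquicont_all` serving every configuration).
[cite: DuminilCopinICM2022, §8.4 p. 29] [cite: AizenmanDuminilCopinAnnals2021, arXiv:1912.07973 Remark 5.10 and Def. 5.11] -/
theorem stub_equicontinuity_inner_of_step
    (hstep : (∀ u : ℕ → ℝ, Tendsto u atTop (𝓝[>] (0 : ℝ)) →
        ∀ (a b : ℕ) (i₀ : Fin a) (g : Site 3), IsCubicDir g →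
        ∀ (T κ η₀ M : ℝ), 0 < κ → 0 < η₀ →
        ∀ K : Set (Fin (a + b) → EuclideanSpace ℝ (Fin 3)), IsCompact K →
        K ⊆ NonCoincident 3 (a + b) →
        (∀ x ∈ K, (∀ j : Fin a, rdotZ g (x (Fin.castAdd b j)) + κ ≤ T) ∧
          (∀ j : Fin b, T + κ ≤ rdotZ g (x (Fin.natAdd a j)))) →
        (∀ᶠ k in atTop, ∀ z ∈ Metric.cthickening η₀ (doubledB g T '' K),
          |rescaledCorrelator (criticalCorr 3) rhoPin (b + b) (u k) z| ≤ M) →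
        SVEquicont u (a + a) (Metric.cthickening η₀ (doubledA g T '' K)) (Fin.castAdd a i₀) →
        SVEquicont u (a + b) K (Fin.castAdd b i₀))) :
    ∀ (Δ c : ℝ), 0 < c →
      Tendsto (fun y : Site 3 => criticalTwoPoint 3 y * Real.sqrt (∑ i, ((y i : ℝ)) ^ 2) ^ (2 * Δ))
        cofinite (𝓝 c) →
      ∀ u : ℕ → ℝ, Tendsto u atTop (𝓝[>] (0 : ℝ)) →
        ∀ (N : ℕ) (K : Set (Fin N → EuclideanSpace ℝ (Fin 3))), IsCompact K → K ⊆ NonCoincident 3 N →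
          ∀ i : Fin N, ∃ κ > 0, ∀ ε > 0, ∃ η > 0, ∀ᶠ k in atTop, ∀ x ∈ K, ∀ x' ∈ K,
            (∀ j, j ≠ i → x' j = x j) →
            ¬ (∃ τ : Fin 3, (∀ j, j ≠ i → x i τ + κ ≤ x j τ) ∨ (∀ j, j ≠ i → x j τ + κ ≤ x i τ)) →
            dist x x' < η →
              |rescaledCorrelator (criticalCorr 3) rhoPin N (u k) x -
                rescaledCorrelator (criticalCorr 3) rhoPin N (u k) x'| < ε := by
  intro Δ c hc hG u hu N K hK hKs i
  refine ⟨1, one_pos, fun ε hε => ?_⟩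
  obtain ⟨η, hη, h⟩ := svEquicont_all_of_step hstep hc hG hu N K hK hKs i ε hε
  exact ⟨η, hη, h.mono fun k hk x hx x' hx' hdiff _ hdist => hk x hx x' hx' hdiff hdist⟩

/-- **Single-variable asymptotic equicontinuity of the pinned zoom at every configuration** (= `svEquicont_all`,
unfolded). [folklore] -/
theorem pinnedZoom_singleVariable_equicontinuity_of_step
    (hstep : (∀ u : ℕ → ℝ, Tendsto u atTop (𝓝[>] (0 : ℝ)) →
        ∀ (a b : ℕ) (i₀ : Fin a) (g : Site 3), IsCubicDir g →
        ∀ (T κ η₀ M : ℝ), 0 < κ → 0 < η₀ →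
        ∀ K : Set (Fin (a + b) → EuclideanSpace ℝ (Fin 3)), IsCompact K →
        K ⊆ NonCoincident 3 (a + b) →
        (∀ x ∈ K, (∀ j : Fin a, rdotZ g (x (Fin.castAdd b j)) + κ ≤ T) ∧
          (∀ j : Fin b, T + κ ≤ rdotZ g (x (Fin.natAdd a j)))) →
        (∀ᶠ k in atTop, ∀ z ∈ Metric.cthickening η₀ (doubledB g T '' K),
          |rescaledCorrelator (criticalCorr 3) rhoPin (b + b) (u k) z| ≤ M) →
        SVEquicont u (a + a) (Metric.cthickening η₀ (doubledA g T '' K)) (Fin.castAdd a i₀) →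
        SVEquicont u (a + b) K (Fin.castAdd b i₀)))
    {Δ c : ℝ} (hc : 0 < c)
    (hG : Tendsto (fun y : Site 3 => criticalTwoPoint 3 y * Real.sqrt (∑ i, ((y i : ℝ)) ^ 2) ^ (2 * Δ))
      cofinite (𝓝 c))
    {u : ℕ → ℝ} (hu : Tendsto u atTop (𝓝[>] (0 : ℝ))) (N : ℕ)
    (K : Set (Fin N → EuclideanSpace ℝ (Fin 3))) (hK : IsCompact K) (hKs : K ⊆ NonCoincident 3 N)
    (i : Fin N) :
    ∀ ε > 0, ∃ η > 0, ∀ᶠ k in atTop, ∀ x ∈ K, ∀ x' ∈ K,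
      (∀ j, j ≠ i → x' j = x j) → dist x x' < η →
        |rescaledCorrelator (criticalCorr 3) rhoPin N (u k) x -
          rescaledCorrelator (criticalCorr 3) rhoPin N (u k) x'| < ε :=
  svEquicont_all_of_step hstep hc hG hu N K hK hKs i

/-- **The former STUB 1″ — ASYMPTOTIC EQUICONTINUITY of the pinned `2m`-point zoom off the diagonals,
`m ≥ 2`, now PROVED modulo `stub_equicontinuity_inner` (and the provable toolkit pieces
`moveIneq_latticeRP`, `sepMove_equicontinuity`, `telescoping_equicontinuity`).** Under the two-point
law (item 0634's data as hypotheses), along every mesh sequence `u k → 0⁺` and on every compact set `K`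
of non-coincident `2m`-point configurations, for every `ε > 0` there is `η > 0` such that eventually in
`k`, `|F(x) − F(y)| < ε` whenever `x, y ∈ K`, `dist x y < η`. Implied by the crux (refuter, landed
`Negative/OnlyInteractionTightness.lean`, `Negative/AsympEquicontinuity.lean`).
[cite: DuminilCopinICM2022, §8.4 p. 29] -/
theorem stub_equicontinuity_ge_four_of_step
    (hstep : (∀ u : ℕ → ℝ, Tendsto u atTop (𝓝[>] (0 : ℝ)) →
        ∀ (a b : ℕ) (i₀ : Fin a) (g : Site 3), IsCubicDir g →
        ∀ (T κ η₀ M : ℝ), 0 < κ → 0 < η₀ →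
        ∀ K : Set (Fin (a + b) → EuclideanSpace ℝ (Fin 3)), IsCompact K →
        K ⊆ NonCoincident 3 (a + b) →
        (∀ x ∈ K, (∀ j : Fin a, rdotZ g (x (Fin.castAdd b j)) + κ ≤ T) ∧
          (∀ j : Fin b, T + κ ≤ rdotZ g (x (Fin.natAdd a j)))) →
        (∀ᶠ k in atTop, ∀ z ∈ Metric.cthickening η₀ (doubledB g T '' K),
          |rescaledCorrelator (criticalCorr 3) rhoPin (b + b) (u k) z| ≤ M) →
        SVEquicont u (a + a) (Metric.cthickening η₀ (doubledA g T '' K)) (Fin.castAdd a i₀) →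
        SVEquicont u (a + b) K (Fin.castAdd b i₀))) :
    ∀ (Δ c : ℝ), 0 < c →
      Tendsto (fun y : Site 3 => criticalTwoPoint 3 y * Real.sqrt (∑ i, ((y i : ℝ)) ^ 2) ^ (2 * Δ))
        cofinite (𝓝 c) →
      ∀ u : ℕ → ℝ, Tendsto u atTop (𝓝[>] (0 : ℝ)) →
        ∀ m : ℕ, 2 ≤ m →
          ∀ (K : Set (Fin (2 * m) → EuclideanSpace ℝ (Fin 3))), IsCompact K → K ⊆ NonCoincident 3 (2 * m) →
            ∀ ε > 0, ∃ η > 0, ∀ᶠ k in atTop, ∀ x ∈ K, ∀ y ∈ K, dist x y < η →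
              |rescaledCorrelator (criticalCorr 3) rhoPin (2 * m) (u k) x -
                rescaledCorrelator (criticalCorr 3) rhoPin (2 * m) (u k) y| < ε := by
  intro Δ c hc hG u hu m _hm K hK hKs
  exact telescoping_equicontinuity (2 * m)
    (fun k x => rescaledCorrelator (criticalCorr 3) rhoPin (2 * m) (u k) x) (NonCoincident 3 (2 * m))
    (isOpen_nonCoincident 3 (2 * m))
    (fun K' hK' hK's i => pinnedZoom_singleVariable_equicontinuity_of_step hstep hc hG hu (2 * m) K' hK' hK's i) K hK hKs

/-- **Asymptotic equicontinuity of the pinned zoom at ALL orders, modulo STUB 1″**: order `0` is the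
constant `1`, odd orders vanish identically (`criticalCorr_eq_zero_of_odd`, `m*(β_c) = 0`), order `2` is
the landed `pinnedZoomEquicontinuous_two`, even orders `≥ 4` are `stub_equicontinuity_ge_four`. [folklore] -/
theorem pinnedZoom_equicontinuity_of_step
    (hstep : (∀ u : ℕ → ℝ, Tendsto u atTop (𝓝[>] (0 : ℝ)) →
        ∀ (a b : ℕ) (i₀ : Fin a) (g : Site 3), IsCubicDir g →
        ∀ (T κ η₀ M : ℝ), 0 < κ → 0 < η₀ →
        ∀ K : Set (Fin (a + b) → EuclideanSpace ℝ (Fin 3)), IsCompact K →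
        K ⊆ NonCoincident 3 (a + b) →
        (∀ x ∈ K, (∀ j : Fin a, rdotZ g (x (Fin.castAdd b j)) + κ ≤ T) ∧
          (∀ j : Fin b, T + κ ≤ rdotZ g (x (Fin.natAdd a j)))) →
        (∀ᶠ k in atTop, ∀ z ∈ Metric.cthickening η₀ (doubledB g T '' K),
          |rescaledCorrelator (criticalCorr 3) rhoPin (b + b) (u k) z| ≤ M) →
        SVEquicont u (a + a) (Metric.cthickening η₀ (doubledA g T '' K)) (Fin.castAdd a i₀) →
        SVEquicont u (a + b) K (Fin.castAdd b i₀))) :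
    ∀ (Δ c : ℝ), 0 < c →
      Tendsto (fun y : Site 3 => criticalTwoPoint 3 y * Real.sqrt (∑ i, ((y i : ℝ)) ^ 2) ^ (2 * Δ))
        cofinite (𝓝 c) →
      ∀ u : ℕ → ℝ, Tendsto u atTop (𝓝[>] (0 : ℝ)) →
        ∀ n (K : Set (Fin n → EuclideanSpace ℝ (Fin 3))), IsCompact K → K ⊆ NonCoincident 3 n →
          ∀ ε > 0, ∃ η > 0, ∀ᶠ k in atTop, ∀ x ∈ K, ∀ y ∈ K, dist x y < η →
            |rescaledCorrelator (criticalCorr 3) rhoPin n (u k) x -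
              rescaledCorrelator (criticalCorr 3) rhoPin n (u k) y| < ε := by
  intro Δ c hc hG u hu n K hK hKs ε hε
  rcases Nat.even_or_odd n with ⟨m, hm⟩ | hodd
  · obtain rfl : n = 2 * m := by omega
    rcases Nat.lt_or_ge m 2 with hm2 | hm2
    · interval_cases m
      · -- order 0: the configuration space is a single point
        refine ⟨1, one_pos, Filter.Eventually.of_forall fun k x _ y _ _ => ?_⟩
        have hxy : x = y := funext fun i => absurd i.2 (by omega)
        subst hxy
        simpa using hε
      · exact pinnedZoomEquicontinuous_two Δ c hc hG u hu K hK hKs ε hε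
    · exact stub_equicontinuity_ge_four_of_step hstep Δ c hc hG u hu m hm2 K hK hKs ε hε
  · -- odd orders vanish identically on the lattice
    refine ⟨1, one_pos, Filter.Eventually.of_forall fun k x _ y _ _ => ?_⟩
    rw [rescaledCorrelator_apply, rescaledCorrelator_apply, criticalCorr_eq_zero_of_odd (d := 3) le_rfl hodd,
      criticalCorr_eq_zero_of_odd (d := 3) le_rfl hodd]
    simpa using hε

/-- **Registered anchor `pinnedZoom_compactness_of_step` — COMPACTNESS of the pinned zoom with REGULAR cluster
points (STUB 1) modulo the recursion step `hstep`**, from the landed sub-goals `compactnessSchema` (abstract Arzelà–Ascoli / Cantor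
diagonal, p72765), `pinnedZoomLocallyBounded` (Gaussian pairing bound + two-point doubling under 0634,
p73886) and `pinnedZoomTranslationInvariant` (equicontinuity + lattice translation invariance, p74332):
under the two-point law every mesh sequence `u k → 0⁺` has a subsequence along which, for every `n` at
once, the pinned rescaled critical correlators converge locally uniformly off the diagonals to a
normalised, continuous-off-diagonals, translation-invariant family. [folklore] -/
theorem pinnedZoom_compactness_of_step :
    (∀ u : ℕ → ℝ, Tendsto u atTop (𝓝[>] (0 : ℝ)) →
      ∀ (a b : ℕ) (i₀ : Fin a) (g : Site 3), IsCubicDir g →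
      ∀ (T κ η₀ M : ℝ), 0 < κ → 0 < η₀ →
      ∀ K : Set (Fin (a + b) → EuclideanSpace ℝ (Fin 3)), IsCompact K →
      K ⊆ NonCoincident 3 (a + b) →
      (∀ x ∈ K, (∀ j : Fin a, rdotZ g (x (Fin.castAdd b j)) + κ ≤ T) ∧
        (∀ j : Fin b, T + κ ≤ rdotZ g (x (Fin.natAdd a j)))) →
      (∀ᶠ k in atTop, ∀ z ∈ Metric.cthickening η₀ (doubledB g T '' K),
        |rescaledCorrelator (criticalCorr 3) rhoPin (b + b) (u k) z| ≤ M) →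
      SVEquicont u (a + a) (Metric.cthickening η₀ (doubledA g T '' K)) (Fin.castAdd a i₀) →
      SVEquicont u (a + b) K (Fin.castAdd b i₀)) →
    ∀ (Δ c : ℝ), 0 < c →
      Tendsto (fun y : Site 3 => criticalTwoPoint 3 y * Real.sqrt (∑ i, ((y i : ℝ)) ^ 2) ^ (2 * Δ))
        cofinite (𝓝 c) →
    ∀ u : ℕ → ℝ, Tendsto u atTop (𝓝[>] (0 : ℝ)) →
      ∃ (φ : ℕ → ℕ) (S : CorrFamily 3), StrictMono φ ∧ IsRegular S ∧
        ∀ n, TendstoLocallyUniformlyOn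
          (fun k => rescaledCorrelator (criticalCorr 3) rhoPin n (u (φ k))) (S n) atTop
          (NonCoincident 3 n) := by
  intro hstep Δ c hc hG u hu
  obtain ⟨φ, S, hφ, hnorm, hcont, hconv⟩ := compactnessSchema
    (fun n k x => rescaledCorrelator (criticalCorr 3) rhoPin n (u k) x)
    (fun n K hK hKs => pinnedZoomLocallyBounded Δ c hc hG u hu n K hK hKs)
    (fun n K hK hKs => pinnedZoom_equicontinuity_of_step hstep Δ c hc hG u hu n K hK hKs)
  have hu' : Tendsto (u ∘ φ) atTop (𝓝[>] (0 : ℝ)) := hu.comp hφ.tendsto_atTop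
  refine ⟨φ, S, hφ, ⟨hnorm, hcont, ?_⟩, hconv⟩
  exact pinnedZoomTranslationInvariant (u ∘ φ) hu'
    (fun n K hK hKs => pinnedZoom_equicontinuity_of_step hstep Δ c hc hG (u ∘ φ) hu' n K hK hKs) S hnorm hconv

end Summit.CriticalPhenomena.Ising3DConformalLimit.MoebiusLimitExistsOnlyInteraction

end
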